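import Literature.AlgebraicTopology.Homotopy.StrongDeformationRetract
import Mathlib.Analysis.Normed.Module.Basic
import HarnessLib

/-!
# The square strong deformation retracts onto the cross of its two diameters

Topic `Literature/AlgebraicTopology/Homotopy`; a small explicit deformation used by the fact seat
`provefact-Literature.Topology.FourManifolds.exists-cbed50d78a` (the tip patch of the flower
surface, a square chart, retracts onto its trace on the spine, the two diameters).

In `ℝ × ℝ` with the sup norm the closed unit ball is the square `[-1, 1]²`.  The map
`ρ(x, y) = (x - clamp(x; -|y|, |y|), y - clamp(y; -|x|, |x|))`, `clamp(x; -a, a) = max (-a) (min a x)`,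
is a continuous retraction of the plane onto the **cross** `{x = 0} ∪ {y = 0}`
(`ρ(x, y) = (sgn x (|x| - |y|)₊, sgn y (|y| - |x|)₊)`), it does not increase `|x|`, `|y|`, and the
straight-line homotopy to it fixes the cross: so `cross ∩ B̄(0,1)` is a strong deformation retract of
`B̄(0, 1)` (`isStrongDeformationRetractOf_cross_closedBall`), indeed of every closed ball about the
origin.  Everything is proved; no named facts.

## References

* A. Hatcher, *Algebraic Topology*, CUP (2002), Ch. 0 p. 2 (deformation retractions).
  [HatcherAT2002]
-/

open Set Function Metric
open scoped Topology unitInterval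

noncomputable section

namespace Literature.AlgebraicTopology.Homotopy

namespace SquareCross

/-- The **cross**: the union of the two coordinate axes of `ℝ × ℝ`. [folklore] -/
def cross : Set (ℝ × ℝ) := {z | z.1 = 0 ∨ z.2 = 0}

/-- The clamp of `x` to `[-a, a]`. [folklore] -/
def clamp (a x : ℝ) : ℝ := max (-a) (min a x)

/-- The clamp is jointly continuous. [folklore] -/
theorem continuous_clamp : Continuous fun p : ℝ × ℝ => clamp p.1 p.2 := by
  unfold clamp; fun_prop

/-- `x - clamp(x; -|y|, |y|)` has absolute value `≤ |x|` and the sign of `x`: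
precisely `|x - clamp| = max 0 (|x| - |y|)`. [folklore] -/
theorem sub_clamp_eq (x y : ℝ) :
    x - clamp |y| x = if |x| ≤ |y| then 0 else (if 0 ≤ x then x - |y| else x + |y|) := by
  unfold clamp
  have hy := abs_nonneg y
  split_ifs with h1 h2
  · rw [abs_le] at h1
    rw [min_eq_right h1.2, max_eq_right h1.1, sub_self]
  · push Not at h1
    rw [abs_of_nonneg h2] at h1
    rw [min_eq_left h1.le, max_eq_right (by linarith)]
  · push Not at h1 h2
    rw [abs_of_neg h2] at h1
    rw [min_eq_right (by linarith), max_eq_left (by linarith)]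
    ring

/-- `|x - clamp(x; -|y|, |y|)| ≤ |x|`. [folklore] -/
theorem abs_sub_clamp_le (x y : ℝ) : |x - clamp |y| x| ≤ |x| := by
  rw [sub_clamp_eq]
  split_ifs with h1 h2
  · rw [abs_zero]; exact abs_nonneg x
  · push Not at h1
    rw [abs_of_nonneg h2] at h1
    rw [abs_of_nonneg (by linarith : 0 ≤ x - |y|), abs_of_nonneg h2]
    linarith [abs_nonneg y]
  · push Not at h1 h2
    rw [abs_of_neg h2] at h1
    rw [abs_of_nonpos (by linarith [abs_nonneg y]), abs_of_neg h2]
    linarith [abs_nonneg y]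

/-- If `|x| ≤ |y|` then `x - clamp(x; -|y|, |y|) = 0`. [folklore] -/
theorem sub_clamp_eq_zero {x y : ℝ} (h : |x| ≤ |y|) : x - clamp |y| x = 0 := by
  rw [sub_clamp_eq, if_pos h]

/-- `clamp(x; 0, 0) = 0`. [folklore] -/
theorem clamp_zero_left (x : ℝ) : clamp 0 x = 0 := by
  unfold clamp
  rcases le_total 0 x with h | h
  · rw [min_eq_left h, neg_zero, max_self]
  · rw [min_eq_right h, neg_zero, max_eq_left h]

/-- **The cross retraction** `ρ(x, y) = (x - clamp(x; ∓|y|), y - clamp(y; ∓|x|))`. [folklore] -/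
def crossRetract (z : ℝ × ℝ) : ℝ × ℝ := (z.1 - clamp |z.2| z.1, z.2 - clamp |z.1| z.2)

/-- The cross retraction is continuous. [folklore] -/
theorem continuous_crossRetract : Continuous crossRetract := by
  unfold crossRetract
  refine (continuous_fst.sub ?_).prodMk (continuous_snd.sub ?_)
  · exact continuous_clamp.comp ((continuous_abs.comp continuous_snd).prodMk continuous_fst)
  · exact continuous_clamp.comp ((continuous_abs.comp continuous_fst).prodMk continuous_snd)

/-- The cross retraction lands on the cross. [folklore] -/
theorem crossRetract_mem (z : ℝ × ℝ) : crossRetract z ∈ cross := by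
  rcases le_total |z.1| |z.2| with h | h
  · exact Or.inl (sub_clamp_eq_zero h)
  · exact Or.inr (sub_clamp_eq_zero h)

/-- The cross retraction fixes the cross. [folklore] -/
theorem crossRetract_eq_self {z : ℝ × ℝ} (hz : z ∈ cross) : crossRetract z = z := by
  obtain ⟨x, y⟩ := z
  rcases hz with h | h <;> simp only at h <;> subst h
  · refine Prod.ext ?_ ?_
    · show 0 - clamp |y| 0 = 0
      rw [sub_clamp_eq_zero (by rw [abs_zero]; exact abs_nonneg y)]
    · show y - clamp |(0:ℝ)| y = y
      rw [abs_zero, clamp_zero_left, sub_zero]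
  · refine Prod.ext ?_ ?_
    · show x - clamp |(0:ℝ)| x = x
      rw [abs_zero, clamp_zero_left, sub_zero]
    · show 0 - clamp |x| 0 = 0
      rw [sub_clamp_eq_zero (by rw [abs_zero]; exact abs_nonneg x)]

/-- The cross retraction does not increase the sup norm. [folklore] -/
theorem norm_crossRetract_le (z : ℝ × ℝ) : ‖crossRetract z‖ ≤ ‖z‖ := by
  rw [Prod.norm_def, Prod.norm_def, Real.norm_eq_abs, Real.norm_eq_abs, Real.norm_eq_abs,
    Real.norm_eq_abs]
  exact max_le_max (abs_sub_clamp_le z.1 z.2) (abs_sub_clamp_le z.2 z.1)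

/-- **The straight-line deformation** `H_s(z) = (1 - s) z + s ρ(z)`. [folklore] -/
def crossDeform (s : ℝ) (z : ℝ × ℝ) : ℝ × ℝ := (1 - s) • z + s • crossRetract z

/-- The deformation is continuous. [folklore] -/
theorem continuous_crossDeform : Continuous fun p : ℝ × (ℝ × ℝ) => crossDeform p.1 p.2 := by
  unfold crossDeform
  have := continuous_crossRetract
  fun_prop

/-- The deformation stays in every closed ball about the origin (`s ∈ [0, 1]`). [folklore] -/
theorem crossDeform_mem_closedBall {R : ℝ} {s : ℝ} (hs : s ∈ Icc (0 : ℝ) 1) {z : ℝ × ℝ}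
    (hz : z ∈ closedBall (0 : ℝ × ℝ) R) : crossDeform s z ∈ closedBall (0 : ℝ × ℝ) R := by
  rw [mem_closedBall, dist_zero_right] at hz ⊢
  rw [crossDeform]
  calc ‖(1 - s) • z + s • crossRetract z‖ ≤ ‖(1 - s) • z‖ + ‖s • crossRetract z‖ := norm_add_le _ _
    _ = (1 - s) * ‖z‖ + s * ‖crossRetract z‖ := by
        rw [norm_smul, norm_smul, Real.norm_eq_abs, Real.norm_eq_abs, abs_of_nonneg (by linarith [hs.2]),
          abs_of_nonneg hs.1]
    _ ≤ (1 - s) * ‖z‖ + s * ‖z‖ := by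
        have := norm_crossRetract_le z
        nlinarith [hs.1]
    _ = ‖z‖ := by ring
    _ ≤ R := hz

/-- **The closed ball strong deformation retracts onto its cross** (its two diameters), for the sup
norm on `ℝ × ℝ` (the square). [cite: HatcherAT2002, Ch. 0, p. 2] -/
theorem isStrongDeformationRetractOf_cross_closedBall (R : ℝ) :
    IsStrongDeformationRetractOf (cross ∩ closedBall (0 : ℝ × ℝ) R) (closedBall (0 : ℝ × ℝ) R) := by
  refine IsStrongDeformationRetractOf.of_continuousOn crossDeform continuous_crossDeform.continuousOn
    (fun s hs z hz => crossDeform_mem_closedBall hs hz) (fun z _ => ?_) (fun z hz => ?_)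
    (fun s _ z _ hzc => ?_)
  · simp [crossDeform]
  · refine ⟨?_, crossDeform_mem_closedBall ⟨zero_le_one, le_rfl⟩ hz⟩
    simp only [crossDeform, sub_self, zero_smul, zero_add, one_smul]
    exact crossRetract_mem z
  · rw [crossDeform, crossRetract_eq_self hzc.1]
    rw [← add_smul]; simp

end SquareCross

end Literature.AlgebraicTopology.Homotopy
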